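import Summits.ValiantsHypothesis.ValiantsHypothesis.Theorems.GeneratorObstructionsPerGenDegreeSuperQPBalancedMonomialRays

/-!
# Route GeneratorObstructions — K1 `PerGenDegreeSuperQP` (stmt-ValiantsHypothesis-11654),
# line `per-side-atoms`: COLUMN-COLLAPSED PERMANENTS are polystable, so the rays `j = m·r`
# (`r ∣ m`) of `S(per_m)` — lengths strictly between `m` and `m²` — are hit and carry atoms

Tenth support file of the line (companions `…AtomCertificates`, …, `…RayCriterion`,
`…BalancedMonomialRays`). `…RectangularRays` proved that a HIT rectangular ray `ℝ₊(1^j)^*` of the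
occurrence monoid `S(per_m) = {χ : HWV_χ(ℂ[Δ_m[per_m]]) ≠ ⊥}` starts with an atom;
`…RayCriterion` that ray `j` is hit iff some `j`-variable degeneration of `per_m` is
`SL_j`-semistable; `…BalancedMonomialRays` settled the Chow rays `j ∣ m` (`j ≤ m`). For the
range of lengths `m < j < m²` — where a LATE start would prove the registered `stub_atomLate`
(`stub_atomLate_of_nullcone_inseparable`) and where nothing was known in print
(Bürgisser–Hüttenhain–Ikenmeyer 2017 only reach `ℓ ≤ n` for `Det_n`) — this file gives the first
unconditional information:

* **Column-collapsed permanents.** For `m = r·t` let `b : [m] → [r]` be the balanced labelling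
  of the columns (`t` columns per label) and substitute `x_{ik} ↦ y_{i, b(k)}`: the form
  `P_{r,t} = per_m(y_{i,b(k)}) = ∑_σ ∏_i y_{σ(i), b(i)}` in the `m r` variables `y_{i,s}`
  (`collapsedPer_eq_sum`; coefficients count permutations, `coeff_collapsedPer`; support =
  the exponents `e_σ = ∑_i ε_{(σ i, b i)}`, `mem_support_collapsedPer_iff`). `r = m`: `per_m`
  itself; `r = 1`: `m!·` the Chow form.
* **`P_{r,t}` is POLYSTABLE** (`isPolystable_collapsedPer`) by BI 2017 Prop. 2.8 in the corrected
  relative-interior form proved in the tree (`isPolystable_of_separating_diagonalStabilizers`):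
  the row torus and the label torus (`∏_s β_s^t = 1`) fix `P_{r,t}` and separate all variables
  (`collapsedPer_separating`), and `(1,…,1)` is the POSITIVE combination
  `∑_σ e_σ / (t·#{σ : σ i₀ = i₀})` of the exponents (`collapsedPer_posCone`: the variable
  `y_{i,s}` has total exponent `#{σ : b(σ⁻¹ i) = s} = t·(m-1)!`, uniformly in `(i,s)`).
* Placing `y_{i,s}` at the matrix position `(i,s)` exhibits `P_{r,t}` as the renaming
  `x_{ik} ↦ x_{i,b(k)}` of `per_m`, a point of `End·per_m ⊆ Δ(per_m)`
  — this placement and the consequences for the rays `j = m·r` of `S(per_m)` (hit, hence an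
  atom on each, by the ray criterion) are in the companion file `…CollapsedPermanentRays`;
  the present file is the polystability proof.

Honest framing: unconditional structure theorems about the permanent's occurrence monoid at
the lengths `m r`, `r ∣ m`; the DEGREES of these atoms are not determined here; `stub_atomLate`
(`c ≥ 2`), K1 and `GenFlipThesis` remain OPEN; nothing here bears on VP versus VNP.
References: [BurgisserIkenmeyer2017] Prop. 2.8 (corrected, tree erratum A31), Cor. 2.9,
Def. 3.3; [BurgisserHuttenhainIkenmeyer2017] Thm. 1; [MulmuleySohoni2001] §4.
-/

set_option linter.dupNamespace false

noncomputable section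

namespace Summit.ValiantsHypothesis.ValiantsHypothesis.Theorems.GeneratorObstructions.PerGenDegreeSuperQP

open MvPolynomial
open Literature.NumberTheory.DiophantineGeometry Literature.Computability.AlgebraicComplexity
  Literature.Computability.Complexity

/-! ### 1. Counting lemmas -/

section Counting

variable {j a : ℕ}

/-- Additive form of `prod_comp_colLabel`: a sum over all `j·a` columns of a function of the
balanced label is `a` times the sum over the labels. [folklore] -/
theorem sum_comp_colLabel {M : Type*} [AddCommMonoid M] (g : Fin j → M) :
    ∑ k : Fin (j * a), g (finProdFinEquiv.symm k).1 = a • ∑ s : Fin j, g s := by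
  rw [← Fintype.sum_equiv finProdFinEquiv (fun p : Fin j × Fin a => g p.1)
    (fun k => g (finProdFinEquiv.symm k).1) (fun p => by simp)]
  rw [Fintype.sum_prod_type, Finset.smul_sum]
  refine Finset.sum_congr rfl fun s _ => ?_
  simp [Finset.sum_const, Fintype.card_fin]

/-- Every fibre of the balanced labelling `k ↦ (k / a)` of `Fin (j·a)` has exactly `a` elements.
[folklore] -/
theorem card_filter_colLabel_eq (s : Fin j) :
    (Finset.univ.filter fun k : Fin (j * a) => (finProdFinEquiv.symm k).1 = s).card = a := by
  classical
  have h := sum_comp_colLabel (a := a) (fun u : Fin j => if u = s then (1 : ℕ) else 0)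
  simp only [Finset.sum_boole, smul_eq_mul, Finset.filter_eq', Finset.mem_univ, if_true,
    Finset.card_singleton] at h
  simpa using h

variable {m : ℕ}

/-- The number of permutations of `Fin m` sending `i` to `k` does not depend on `(i, k)`
(conjugate by transpositions). [folklore] -/
theorem card_filter_perm_apply_eq (i k i' k' : Fin m) :
    (Finset.univ.filter fun σ : Equiv.Perm (Fin m) => σ i = k).card =
      (Finset.univ.filter fun σ : Equiv.Perm (Fin m) => σ i' = k').card := by
  classical
  refine Finset.card_bij' (fun σ _ => Equiv.swap k k' * σ * Equiv.swap i i')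
    (fun σ _ => Equiv.swap k k' * σ * Equiv.swap i i') ?_ ?_ ?_ ?_
  · intro σ hσ
    simp only [Finset.mem_filter, Finset.mem_univ, true_and] at hσ ⊢
    simp [Equiv.Perm.mul_apply, Equiv.swap_apply_right, hσ, Equiv.swap_apply_left]
  · intro σ hσ
    simp only [Finset.mem_filter, Finset.mem_univ, true_and] at hσ ⊢
    simp [Equiv.Perm.mul_apply, Equiv.swap_apply_left, hσ, Equiv.swap_apply_right]
  · intro σ _
    ext x
    simp [Equiv.Perm.mul_apply]
  · intro σ _
    ext x
    simp [Equiv.Perm.mul_apply]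

end Counting

/-! ### 2. The column-collapsed permanent on `(r t)·r` variables -/

section Collapsed

variable {r t : ℕ}

/-- `per_n` on `Fin n × Fin n`, expanded over permutations: `∑_σ ∏_i x_{σ(i), i}`. [folklore] -/
theorem perPoly_eq_sum_prod (n : ℕ) :
    perPoly (Fin n) ℂ = ∑ σ : Equiv.Perm (Fin n), ∏ i : Fin n, X (σ i, i) := by
  unfold perPoly Matrix.permanent
  simp [Matrix.mvPolynomialX]

/-- **The column-collapsed permanent** `P = per_m(x_{ik} ↦ y_{i, b(k)})`, `m = r t`, `b(k) = k / t`
the balanced labelling of the columns by `r` labels, the `m r` variables `y_{i,s}` numbered by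
`finProdFinEquiv`: as a sum over permutations, `P = ∑_σ ∏_i y_{σ(i), b(i)}`. [folklore] -/
theorem collapsedPer_eq_sum :
    MvPolynomial.rename
        (fun ik : Fin (r * t) × Fin (r * t) =>
          (finProdFinEquiv (ik.1, (finProdFinEquiv.symm ik.2).1) : Fin (r * t * r)))
        (perPoly (Fin (r * t)) ℂ) =
      ∑ σ : Equiv.Perm (Fin (r * t)), ∏ i : Fin (r * t),
        X (finProdFinEquiv (σ i, (finProdFinEquiv.symm i).1) : Fin (r * t * r)) := by
  rw [perPoly_eq_sum_prod, map_sum]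
  simp only [map_prod, rename_X]

/-- The monomial of `P` indexed by `σ`, as a product of variables, is the monomial with exponent
`e_σ = ∑_i ε_{(σ i, b i)}`. [folklore] -/
theorem prod_X_eq_monomial_sum_single (σ : Equiv.Perm (Fin (r * t))) :
    (∏ i : Fin (r * t), X (finProdFinEquiv (σ i, (finProdFinEquiv.symm i).1) : Fin (r * t * r)) :
        MvPolynomial (Fin (r * t * r)) ℂ) =
      monomial (∑ i : Fin (r * t),
        Finsupp.single (finProdFinEquiv (σ i, (finProdFinEquiv.symm i).1) : Fin (r * t * r)) 1) 1 := by
  rw [monomial_sum_one]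
  rfl

/-- **Coefficients of the collapsed permanent count permutations**: the coefficient of `α` in `P`
is the number of `σ` with `e_σ = α`. [folklore] -/
theorem coeff_collapsedPer (α : Fin (r * t * r) →₀ ℕ) :
    coeff α (MvPolynomial.rename
        (fun ik : Fin (r * t) × Fin (r * t) =>
          (finProdFinEquiv (ik.1, (finProdFinEquiv.symm ik.2).1) : Fin (r * t * r)))
        (perPoly (Fin (r * t)) ℂ)) =
      ((Finset.univ.filter fun σ : Equiv.Perm (Fin (r * t)) =>
        (∑ i : Fin (r * t),
          Finsupp.single (finProdFinEquiv (σ i, (finProdFinEquiv.symm i).1) : Fin (r * t * r)) 1) = α).card : ℂ) := by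
  classical
  rw [collapsedPer_eq_sum, coeff_sum]
  simp only [prod_X_eq_monomial_sum_single, coeff_monomial, Finset.sum_boole]

/-- The support of the collapsed permanent is exactly the set of exponents `e_σ`. [folklore] -/
theorem mem_support_collapsedPer_iff (α : Fin (r * t * r) →₀ ℕ) :
    α ∈ (MvPolynomial.rename
        (fun ik : Fin (r * t) × Fin (r * t) =>
          (finProdFinEquiv (ik.1, (finProdFinEquiv.symm ik.2).1) : Fin (r * t * r)))
        (perPoly (Fin (r * t)) ℂ)).support ↔
      ∃ σ : Equiv.Perm (Fin (r * t)),
        (∑ i : Fin (r * t),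
          Finsupp.single (finProdFinEquiv (σ i, (finProdFinEquiv.symm i).1) : Fin (r * t * r)) 1) = α := by
  classical
  rw [mem_support_iff, coeff_collapsedPer, Nat.cast_ne_zero, ← Nat.pos_iff_ne_zero, Finset.card_pos,
    Finset.filter_nonempty_iff]
  simp

/-- The collapsed permanent is a form of degree `m = r t`. [folklore] -/
theorem collapsedPer_isHomogeneous :
    (MvPolynomial.rename
        (fun ik : Fin (r * t) × Fin (r * t) =>
          (finProdFinEquiv (ik.1, (finProdFinEquiv.symm ik.2).1) : Fin (r * t * r)))
        (perPoly (Fin (r * t)) ℂ)).IsHomogeneous (r * t) := by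
  simpa [Fintype.card_fin] using
    (perPoly_isHomogeneous (n := Fin (r * t)) (k := ℂ)).rename_isHomogeneous
      (f := fun ik : Fin (r * t) × Fin (r * t) =>
        (finProdFinEquiv (ik.1, (finProdFinEquiv.symm ik.2).1) : Fin (r * t * r)))

/-- The collapsed permanent is nonzero (the exponent `e_1` occurs). [folklore] -/
theorem collapsedPer_ne_zero :
    MvPolynomial.rename
        (fun ik : Fin (r * t) × Fin (r * t) =>
          (finProdFinEquiv (ik.1, (finProdFinEquiv.symm ik.2).1) : Fin (r * t * r)))
        (perPoly (Fin (r * t)) ℂ) ≠ 0 := by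
  intro h
  have hmem := (mem_support_collapsedPer_iff (r := r) (t := t) _).mpr ⟨1, rfl⟩
  rw [h, support_zero] at hmem
  exact absurd hmem (Finset.notMem_empty _)

/-- **Diagonal substitutions fixing the collapsed permanent**: if `∏_i d(σ i, b i) = 1` for every
permutation `σ`, then `diag(d)` fixes `P`. [folklore] -/
theorem linSubst_diagonal_collapsedPer_eq (d : Fin (r * t * r) → ℂ)
    (hd : ∀ σ : Equiv.Perm (Fin (r * t)),
      ∏ i : Fin (r * t), d (finProdFinEquiv (σ i, (finProdFinEquiv.symm i).1)) = 1) :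
    linSubst (Fin (r * t * r)) ℂ (Matrix.diagonal d)
        (MvPolynomial.rename
          (fun ik : Fin (r * t) × Fin (r * t) =>
            (finProdFinEquiv (ik.1, (finProdFinEquiv.symm ik.2).1) : Fin (r * t * r)))
          (perPoly (Fin (r * t)) ℂ)) =
      MvPolynomial.rename
        (fun ik : Fin (r * t) × Fin (r * t) =>
          (finProdFinEquiv (ik.1, (finProdFinEquiv.symm ik.2).1) : Fin (r * t * r)))
        (perPoly (Fin (r * t)) ℂ) := by
  classical
  rw [collapsedPer_eq_sum, map_sum]
  refine Finset.sum_congr rfl fun σ _ => ?_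
  rw [prod_X_eq_monomial_sum_single, linSubst_diagonal_monomial]
  have hprod : ((∑ i : Fin (r * t),
      Finsupp.single (finProdFinEquiv (σ i, (finProdFinEquiv.symm i).1) : Fin (r * t * r)) 1).prod
        fun x n => d x ^ n) = 1 := by
    rw [← hd σ, ← Finsupp.prod_finsetSum_index (fun _ => pow_zero _) (fun _ _ _ => pow_add _ _ _)]
    refine Finset.prod_congr rfl fun i _ => ?_
    rw [Finsupp.prod_single_index (h := fun x n => d x ^ n) (pow_zero _), pow_one]
  rw [hprod, one_smul]

end Collapsed

/-! ### 3. Polystability of the collapsed permanent (BI 2017 Prop. 2.8, corrected form) -/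

section Polystable

variable {r t : ℕ}

/-- A product with one factor `2`, one factor `1/2` and all other factors `1` equals `1`. [folklore] -/
theorem prod_ite_ite_eq_one {ι : Type*} [Fintype ι] [DecidableEq ι] {i i' : ι} (h : i ≠ i') :
    ∏ l : ι, (if l = i then (2 : ℂ) else if l = i' then (1 / 2 : ℂ) else 1) = 1 := by
  have key : ∀ l : ι, (if l = i then (2 : ℂ) else if l = i' then (1 / 2 : ℂ) else 1) =
      (if l = i then (2 : ℂ) else 1) * (if l = i' then (1 / 2 : ℂ) else 1) := by
    intro l
    by_cases h1 : l = i
    · subst h1; simp [h]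
    · simp [h1]
  simp_rw [key]
  rw [Finset.prod_mul_distrib, Finset.prod_ite_eq', Finset.prod_ite_eq']
  norm_num

/-- **Separating diagonal stabilizers of the collapsed permanent** (hypothesis 1' of the
corrected BI 2017 Prop. 2.8): any two of the `m r` variables `y_{i,s} ≠ y_{i',s'}` are separated by
a diagonal substitution fixing `P` — a row scaling `(2 on row i, ½ on row i')` if `i ≠ i'` (every
monomial of `P` uses each row once), a label scaling `(2 on label s, ½ on label s')` if `s ≠ s'`
(every monomial uses each label exactly `t` times). [cite: BurgisserIkenmeyer2017, Prop. 2.8 and Cor. 2.9 (proof)] -/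
theorem collapsedPer_separating (x x' : Fin (r * t * r)) (hxx : x ≠ x') :
    ∃ d : Fin (r * t * r) → ℂ,
      linSubst (Fin (r * t * r)) ℂ (Matrix.diagonal d)
          (MvPolynomial.rename
            (fun ik : Fin (r * t) × Fin (r * t) =>
              (finProdFinEquiv (ik.1, (finProdFinEquiv.symm ik.2).1) : Fin (r * t * r)))
            (perPoly (Fin (r * t)) ℂ)) =
        MvPolynomial.rename
          (fun ik : Fin (r * t) × Fin (r * t) =>
            (finProdFinEquiv (ik.1, (finProdFinEquiv.symm ik.2).1) : Fin (r * t * r)))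
          (perPoly (Fin (r * t)) ℂ) ∧
      d x ≠ d x' := by
  classical
  obtain ⟨⟨i, s⟩, rfl⟩ := finProdFinEquiv.surjective x
  obtain ⟨⟨i', s'⟩, rfl⟩ := finProdFinEquiv.surjective x'
  by_cases hi : i = i'
  · subst hi
    have hs : s ≠ s' := fun h => hxx (by rw [h])
    refine ⟨fun y => if (finProdFinEquiv.symm y).2 = s then 2
        else if (finProdFinEquiv.symm y).2 = s' then 1 / 2 else 1, ?_, ?_⟩
    · apply linSubst_diagonal_collapsedPer_eq
      intro σ
      simp only [Equiv.symm_apply_apply]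
      rw [prod_comp_colLabel (a := t)
        (fun u : Fin r => if u = s then (2 : ℂ) else if u = s' then 1 / 2 else 1),
        prod_ite_ite_eq_one hs, one_pow]
    · simp only [Equiv.symm_apply_apply, if_neg hs.symm]
      norm_num
  · refine ⟨fun y => if (finProdFinEquiv.symm y).1 = i then 2
        else if (finProdFinEquiv.symm y).1 = i' then 1 / 2 else 1, ?_, ?_⟩
    · apply linSubst_diagonal_collapsedPer_eq
      intro σ
      simp only [Equiv.symm_apply_apply]
      rw [Equiv.prod_comp σ (fun l : Fin (r * t) => if l = i then (2 : ℂ) else if l = i' then 1 / 2 else 1)]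
      exact prod_ite_ite_eq_one hi
    · simp only [Equiv.symm_apply_apply, if_neg (Ne.symm hi)]
      norm_num

/-- **Positive cone condition for the collapsed permanent** (hypothesis 2 of the corrected BI 2017
Prop. 2.8): `(1,…,1)` is a combination of the exponents of `P` with ALL coefficients positive —
weight each exponent `e_σ` by the number of permutations producing it; the total exponent of the
variable `y_{i,s}` is then the number of `σ` with `b(σ⁻¹ i) = s`, which is `t · #{σ : σ i₀ = i₀}`
for every `(i,s)`. [cite: BurgisserIkenmeyer2017, Prop. 2.8 and Cor. 2.9 (proof)] -/
theorem collapsedPer_posCone (hr : 0 < r) (ht : 0 < t) :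
    ∃ c : (Fin (r * t * r) →₀ ℕ) → ℚ,
      (∀ α ∈ (MvPolynomial.rename
          (fun ik : Fin (r * t) × Fin (r * t) =>
            (finProdFinEquiv (ik.1, (finProdFinEquiv.symm ik.2).1) : Fin (r * t * r)))
          (perPoly (Fin (r * t)) ℂ)).support, 0 < c α) ∧
      ∀ x : Fin (r * t * r), ∑ α ∈ (MvPolynomial.rename
          (fun ik : Fin (r * t) × Fin (r * t) =>
            (finProdFinEquiv (ik.1, (finProdFinEquiv.symm ik.2).1) : Fin (r * t * r)))
          (perPoly (Fin (r * t)) ℂ)).support, c α * (α x : ℚ) = 1 := by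
  classical
  have hm : 0 < r * t := Nat.mul_pos hr ht
  set i₀ : Fin (r * t) := ⟨0, hm⟩ with hi₀
  set S : ℕ := (Finset.univ.filter fun σ : Equiv.Perm (Fin (r * t)) => σ i₀ = i₀).card with hSdef
  have hS : 0 < S := Finset.card_pos.mpr ⟨1, by simp⟩
  set e : Equiv.Perm (Fin (r * t)) → (Fin (r * t * r) →₀ ℕ) := fun σ =>
    ∑ i : Fin (r * t), Finsupp.single (finProdFinEquiv (σ i, (finProdFinEquiv.symm i).1) : Fin (r * t * r)) 1
    with hedef
  set N : (Fin (r * t * r) →₀ ℕ) → ℕ := fun α =>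
    (Finset.univ.filter fun σ : Equiv.Perm (Fin (r * t)) => e σ = α).card with hNdef
  set P := MvPolynomial.rename
          (fun ik : Fin (r * t) × Fin (r * t) =>
            (finProdFinEquiv (ik.1, (finProdFinEquiv.symm ik.2).1) : Fin (r * t * r)))
          (perPoly (Fin (r * t)) ℂ) with hPdef
  have hsupp : ∀ α, α ∈ P.support ↔ ∃ σ, e σ = α := fun α => mem_support_collapsedPer_iff α
  refine ⟨fun α => (N α : ℚ) / ((t * S : ℕ) : ℚ), ?_, ?_⟩
  · intro α hα
    obtain ⟨σ, hσ⟩ := (hsupp α).mp hα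
    have hN : 0 < N α := Finset.card_pos.mpr ⟨σ, by simp [hσ]⟩
    have hK : 0 < t * S := Nat.mul_pos ht hS
    positivity
  · intro x
    obtain ⟨⟨i, s⟩, rfl⟩ := finProdFinEquiv.surjective x
    have hmaps : ∀ σ ∈ (Finset.univ : Finset (Equiv.Perm (Fin (r * t)))), e σ ∈ P.support :=
      fun σ _ => (hsupp _).mpr ⟨σ, rfl⟩
    -- regroup the sum over the support as a sum over permutations
    have key : ∑ α ∈ P.support, (N α : ℚ) * (α (finProdFinEquiv (i, s)) : ℚ) =
        ∑ σ : Equiv.Perm (Fin (r * t)), ((e σ) (finProdFinEquiv (i, s)) : ℚ) := by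
      rw [← Finset.sum_fiberwise_of_maps_to hmaps]
      refine Finset.sum_congr rfl fun α _ => ?_
      rw [Finset.sum_congr rfl fun σ hσ => by rw [(Finset.mem_filter.mp hσ).2], Finset.sum_const,
        nsmul_eq_mul]
    -- count: the total exponent of `y_{i,s}` over all `σ`
    have h1 : ∀ σ : Equiv.Perm (Fin (r * t)), (e σ) (finProdFinEquiv (i, s)) =
        ∑ i' : Fin (r * t), if σ i' = i ∧ (finProdFinEquiv.symm i').1 = s then 1 else 0 := by
      intro σ
      simp only [hedef, Finsupp.coe_finsetSum, Finset.sum_apply, Finsupp.single_apply,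
        EmbeddingLike.apply_eq_iff_eq, Prod.mk.injEq]
    have h2 : ∀ i' : Fin (r * t),
        (Finset.univ.filter fun σ : Equiv.Perm (Fin (r * t)) =>
          σ i' = i ∧ (finProdFinEquiv.symm i').1 = s).card =
        if (finProdFinEquiv.symm i').1 = s then S else 0 := by
      intro i'
      split_ifs with h
      · rw [hSdef, ← card_filter_perm_apply_eq i' i i₀ i₀]
        congr 1
        ext σ
        simp only [Finset.mem_filter, Finset.mem_univ, true_and]
        exact ⟨fun hσ => hσ.1, fun hσ => ⟨hσ, h⟩⟩
      · rw [Finset.card_eq_zero, Finset.filter_eq_empty_iff]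
        intro σ _ hσ
        exact h hσ.2
    have count : ∑ σ : Equiv.Perm (Fin (r * t)), ((e σ) (finProdFinEquiv (i, s)) : ℚ) =
        ((t * S : ℕ) : ℚ) := by
      rw [← Nat.cast_sum]
      congr 1
      simp_rw [h1]
      rw [Finset.sum_comm]
      simp_rw [Finset.sum_boole, Nat.cast_id, h2]
      rw [Finset.sum_ite, Finset.sum_const_zero, add_zero, Finset.sum_const, smul_eq_mul,
        card_filter_colLabel_eq]
    have hK : ((t * S : ℕ) : ℚ) ≠ 0 := by
      have : 0 < t * S := Nat.mul_pos ht hS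
      exact_mod_cast this.ne'
    simp_rw [div_mul_eq_mul_div, ← Finset.sum_div, key, count]
    exact div_self hK

/-- **The column-collapsed permanent is polystable** (`r, t ≥ 1`): its `SL_{mr}`-orbit is
Zariski closed — BI 2017 Prop. 2.8 in the corrected (relative-interior) form proved in the tree
(`isPolystable_of_separating_diagonalStabilizers`), fed with §3's separating stabilizers and
positive cone. For `r = m` (`t = 1`) this is the polystability of `per_m` itself (BI 2017
Cor. 2.9); for `r = 1` it is the Chow form `y₁⋯y_m`. [cite: BurgisserIkenmeyer2017, Prop. 2.8 and Cor. 2.9] -/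
theorem isPolystable_collapsedPer (hr : 0 < r) (ht : 0 < t) :
    IsPolystable (MvPolynomial.rename
        (fun ik : Fin (r * t) × Fin (r * t) =>
          (finProdFinEquiv (ik.1, (finProdFinEquiv.symm ik.2).1) : Fin (r * t * r)))
        (perPoly (Fin (r * t)) ℂ)) := by
  obtain ⟨c, hcpos, hc⟩ := collapsedPer_posCone hr ht
  exact isPolystable_of_separating_diagonalStabilizers _ collapsedPer_isHomogeneous
    (fun x x' h => collapsedPer_separating x x' h) c hcpos hc

end Polystable

end Summit.ValiantsHypothesis.ValiantsHypothesis.Theorems.GeneratorObstructions.PerGenDegreeSuperQP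

end
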